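import Summits.ABC.IUTFork.Repair.RLana91GenuineBedCells
import Summits.ABC.IUTFork.Cor312PilotIdelesPrInclusion
import Summits.ABC.IUTFork.Cor312MultiradTwist
import HarnessLib

/-!
# REPAIR-CATALOGUE row RC-639, horn (H2) — LANA Rmk 6.2.2 «the value-group part on the input side may exert some influence on the output»
# TYPED at the genuine sharp bed as a CONSTRUCTION `C : q-ideles ↦ Θ-ideles` feeding the Θ-glue, and DECIDED there (D-0123 (C); KEY RC-639 /
# RLANA, seat abc-iut-rcat-tst-9 gen 2)

PROOF-ONLY file (D-0012; no definition, no `Prop` fact; rows RC-639 / RC-130; rung LADDER-ABC:A2). TAKES NO SIDE on [IUTchIII] Cor. 3.12 /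
[IUTchIV] Thm. 1.10, on the LANA authors, or on any author; nothing here asserts abc proved or refuted; decided-as-typed ≠ decided-in-print.
Source of the row: Project LANA interim report `paper:url-7e4c7f9f3efc`, Rmk. 6.2.2 p. 33 l. 60 – p. 34 l. 9: «… it is argued that when an input
accompanied by a value-group portion—such as a q-pilot—is provided, the underlying holomorphic structure is not destroyed by the algorithm (the
(SHE) property discussed later in §8.2); in this sense, the value-group part on the input side may exert some influence on the output. Reconciling
these points remains a topic of discussion among LANA members.» Horn (H1) — the output does not read the input's q-pilot value-group datum — is what
the frozen `Cor312.Setting` realises (gen 0, `Repair.RLana91ValueGroupInput` p513784); horn (H2) had NO typed counterpart there because the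
Θ-regions are a free GLUE field (`thetaRegionOf`, RESIDUAL R1).

THE TYPING. At abc-iut-c312-7's print-normalised sharp real setting `Thm311.Real.settingPrVolSharp X … qData tq t …` the glue IS a construction:
the Θ-regions are READ OFF Θ-ideles `t = (t_{Θ,j,v})` (sharp boxes `ι_j(t_{Θ,j,v_j})·(R_I)^∼`, Dupuy–Hilado §3.7/§3.9) and the q-pilot region off
q-ideles `tq = (t_{q,v})` — the input's value-group part. «The input's value-group portion influences the output» is typed by letting the
Θ-ideles be ANY FUNCTION `C` of the q-ideles («input BPS ↦ thetaRegionOf» = `tq ↦ settingPrVolSharp … tq (C tq) …`); the (SHE) clause «the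
holomorphic structure [giving rise to the Θ-pilot object] is not destroyed» by asking that the output ideles `C tq` still REALISE `P_Θ` (c312-7's
binder `ht`: `log ‖t_{Θ,i+1,v}‖ = −P_{Θ,i+1}(v)·log N(v)/n_v`) — a FAITHFUL construction.

WHAT IS PROVED (ANY pilot data `X` over any number field; inputs non-zero, units off the support).
* §1 NORMS DETERMINE THE OUTPUT: two Θ-ideles with the same norms give, at ANY two inputs, literally the SAME (Ind3)-enlarged regions, possible
  images, holomorphic hulls and `−|log(Θ)|` (`thetaRegion3_/possibleImages_/thetaHull_/negLogTheta_settingPrVolSharp_eq_of_norm_eq`; the sharp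
  translate `ι(a)·(R_I)^∼` depends on `‖a‖` only, abc-iut-c312-7 `iota_smul_normalizedPacket_eq_of_norm_eq_slot`).
* §2 FAITHFUL CONSTRUCTIONS CARRY NO INFLUENCE: `output_indep_of_input_of_faithful` — the whole Θ-side output (regions, possible images, hulls,
  `−|log(Θ)|`) is the same at any two inputs; `not_H_of_faithful` — the typed (9-1) `Repair.CandLana1.H` is FALSE at every input realising `P_q`
  (every global possible image has volume `−deĝ̲_lgp(P_Θ) < −|log(q)|`, abc-iut-s2-p9 / gen 0 `RLana91GenuineBed.not_H_settingPrVolSharp`). AS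
  TYPED horn (H2) is EMPTY for faithful constructions: (SHE)-faithfulness pins the output to the Θ-pilot's norms; the input cannot move it.
* §3 WHAT AN INFLUENCE WOULD HAVE TO BE: if the output ideles carry the q-pilot's norms at every label (`‖t_{Θ,j,v}‖ = ‖t_{q,v}‖`; the «q-MOVER»
  `C tq := (j ↦ tq)` is the instance), the q-pilot region IS a possible image in every packet (`reading3_settingPrVolSharp_of_norm_eq`, by c312-7's
  `qRegion_mem_possibleImages_settingPrVolSharp_of_norm_eq`), the per-cell identification family holds at EVERY cell
  (`forall_cellVolId_settingPrVolSharp_of_norm_eq`, gen 0's `RLana91CellGrain.CellVolId`) and (9-1)-as-typed HOLDS (`H_settingPrVolSharp_of_norm_eq`,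
  `H_settingPrVolSharp_qMover`) — but such output does NOT realise `P_Θ` (`not_realisesTheta_of_norm_eq`, `qMover_not_realisesTheta`): the influence
  that makes (9-1) true REPLACES the Θ-pilot's value-group part (theta values `q^{j²}`, `P_{Θ,j} = j²·P_q`) by the q-pilot's.
* §4 THE GENERAL CONSTRUCTION: `H_settingPrVolSharp_iff_kummerImage` — for ANY non-zero output ideles, (9-1)-as-typed at an input ⟺ the
  procession-normalised volume of the output's own Kummer images is `−|log(q)|`: relativised to a construction the comparison (9-1) is a CONSTRAINT
  ON `C`, not a consequence of having one (abc-iut-c312-4 `LanaProcedure.mainGoal_is_the_extra_input`, now per input).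

READING for the catalogue (numbers, not adjectives; no side). RC-639 H2 = TYPED-AND-DECIDED at the genuine sharp bed: faithful ((SHE) as typed)
⇒ influence NIL ∧ (9-1) FALSE at every input = KILLED-as-supplier; (9-1) TRUE iff the construction hands the output the q-pilot's global volume
(§4), realised by the norm-transfer/q-mover constructions (§3) whose output is no longer the Θ-pilot's — cf. the catalogue's q-mover door RC-513
(`Repair.CandJoshiLanaQMover`, q-side); here the Θ-side twin at the genuine bed. HONEST SCOPE: (a) statements about OUR typed objects — c312-7's
sharp setting reads regions off ideles through their norms, so «influence» can only mean «different norms»; print's (SHE) ([IUTchIII] Rmk. 3.11.1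
(iii) p. 161: «simultaneously valid/executable/well-defined» relative to both arithmetic holomorphic structures) speaks of algorithms, of which `ht`
types only the trace «the output is the Θ-pilot's line bundle»; (b) the realising binders are inhabited over `K` (`exists_ideles_settingPrVolSharp`),
not at F-level pilot data of an initial Θ-datum (`SideVacuity.not_realising_qIdeles_of_isPilotDataOf`); (c) LANA records the point as OPEN among
its members (p. 34 l. 8–9) — decided-as-typed ≠ decided-in-print. [cite: LANA2026Report, Rmk. 6.2.2 p. 33–34; §8.2 (SHE) p. 42; §9.2 (9-1) p. 46]
[cite: Mochizuki2012, IUTchIII Rmk. 3.11.1 (iii) p. 161; Cor. 3.12 p. 173–174; proof Step (x) p. 181] [cite: DupuyHilado2025, §3.3, §3.4, §3.7, §3.9,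
Thm. 3.10.1] [claim: Mochizuki2012, status: disputed] for every quoted construction.
-/

noncomputable section

open Set Function NumberField IsDedekindDomain
open scoped Pointwise

namespace Summit.ABC.IUTFork.Repair.RLana91InputConstruction

open Thm311 Thm311.Real Cor312 Cor312.Setting Cor312Vol Literature.IUT.LogThetaLattice Literature.IUT.LogVolume
  Literature.IUT.HodgeTheaters Literature.NumberTheory.NumberFields Repair.RLana91CellGrain Repair.RLana91GenuineBed

variable {F : Type} [Field F] [NumberField F] (X : PilotData F) {logv : PadicLogs F} (hlog : LogvAnalytic logv)
  (M : Type) [Field M] [NumberField M]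
  (archPk : ∀ (j : (thetaIndex X).Label) (vQ : (thetaIndex X).VQ), Set ((logShellsDH X logv).Packet j vQ))
  (archSub : ∀ (j : (thetaIndex X).Label) (v : (thetaIndex X).V), Set ((logShellsDH X logv).Packet j ((thetaIndex X).over v)))
  (Ψ : ℤ → ∀ v : (thetaIndex X).V, v ∈ (thetaIndex X).Vbad → Set ((logShellsDH X logv).StarPacket v))
  (act : ℤ → ∀ v : (thetaIndex X).V, v ∈ (thetaIndex X).Vbad → (logShellsDH X logv).StarPacket v → Module.End ℚ ((logShellsDH X logv).StarPacket v))
  (Mmod : ℤ → ∀ j : (thetaIndex X).LabelStar, Set ((logShellsDH X logv).GlobalPacket j.1))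
  (region : ℤ → ∀ j : (thetaIndex X).LabelStar, FinDivisor M → ∀ vQ : (thetaIndex X).VQ, Set ((logShellsDH X logv).Packet j.1 vQ))
  (frobAdm : ℤ → ℤ → ∀ (j : (thetaIndex X).Label) (vQ : (thetaIndex X).VQ), Set ((logShellsDH X logv).Packet j vQ) → Prop)
  (frobLogvol : ℤ → ℤ → ∀ (j : (thetaIndex X).Label) (vQ : (thetaIndex X).VQ), Set ((logShellsDH X logv).Packet j vQ) → ℝ)
  (frobΨ : ℤ → ℤ → ∀ v : (thetaIndex X).V, v ∈ (thetaIndex X).Vbad → Set ((logShellsDH X logv).StarPacket v))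
  (frobMmod : ℤ → ℤ → ∀ j : (thetaIndex X).LabelStar, Set ((logShellsDH X logv).GlobalPacket j.1))
  (unitImage : ℤ → ℤ → ℕ → ∀ (j : (thetaIndex X).Label) (vQ : (thetaIndex X).VQ), Set ((logShellsDH X logv).Packet j vQ))
  (ballImage : ℤ → ℤ → ∀ (j : (thetaIndex X).Label) (vQ : (thetaIndex X).VQ), Set ((logShellsDH X logv).Packet j vQ))
  (thetaDiv : ℤ → ℤ → LgpDivisor M (thetaIndex X).lstar)
  (n : ℤ) {HT : Type} {LogLink : HT → HT → Type} {IsFull : ∀ {s t : HT}, LogLink s t → Prop}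
  (lat : LGPGaussianLogThetaLattice LogLink IsFull)
  {Frd : Type} {IsoF : Frd → Frd → Type} {Ob : Frd → Type} {realify : Frd → Frd} {Strip : Type}
  {IsoS : Strip → Strip → Type} {Mv : ∀ v : (thetaIndex X).V, v ∈ (thetaIndex X).Vbad → Type}
  [∀ v h, Monoid (Mv v h)]
  (sig : GlobalLGPFrobenioidSignature (thetaIndex X).lstar (thetaIndex X).V (· ∈ (thetaIndex X).Vbad)
    Frd IsoF Ob realify Strip IsoS Mv)
  (split : SplittingMonoids Mv) {ObΔ : Type} {N : ∀ v : (thetaIndex X).V, v ∈ (thetaIndex X).Vbad → Type}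
  [∀ v h, Monoid (N v h)] (qData : QPilotData ObΔ N)
  (ρ : (∀ v : (thetaIndex X).V, v ∈ (thetaIndex X).Vbad → Set ((logShellsDH X logv).StarPacket v)) →
    ∀ (j : (thetaIndex X).Label) (vQ : (thetaIndex X).VQ), Set ((logShellsDH X logv).Packet j vQ))
  (qK : ∀ v : (thetaIndex X).V, v ∈ (thetaIndex X).Vbad → Set ((logShellsDH X logv).StarPacket v))

/-! ## §1. The output of the sharp setting is a function of the NORMS of the Θ-ideles (any inputs) -/

section Norms

variable (t t' : ∀ (pp : Nat.Primes) (_ : Fin X.lstar) (x : (thetaIndex X).Fibre (.inr pp)),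
    haveI : Fact (pp : ℕ).Prime := ⟨pp.2⟩; kOf X pp.1 x)
  (tq tq' : ∀ (pp : Nat.Primes) (x : (thetaIndex X).Fibre (.inr pp)), haveI : Fact (pp : ℕ).Prime := ⟨pp.2⟩; kOf X pp.1 x)

/-- The hull frame of the sharp setting at `(j, v_ℚ)` is the real frame pulled back along abc-iut-c312-5's factor map — it reads
neither the Θ-ideles nor the q-ideles. [folklore] -/
theorem frame_settingPrVolSharp (htq0 : ∀ pp x, tq pp x ≠ 0)
    (htq1 : ∀ (pp : Nat.Primes) (x : (thetaIndex X).Fibre (.inr pp)), haveI : Fact (pp : ℕ).Prime := ⟨pp.2⟩; placeOf X pp.1 x ∉ X.S → ‖tq pp x‖ = 1)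
    (j : (thetaIndex X).Label) (vQ : (thetaIndex X).VQ) :
    (settingPrVolSharp X hlog M archPk archSub Ψ act Mmod region n lat sig split qData tq t htq0 htq1).frame j vQ =
      HullFrame.ofComparison (factorFieldDH X hlog j vQ) (factorMapDH X hlog j vQ) :=
  rfl

/-- The label idele has the same norm for two Θ-ideles with the same norms (label `0`: both `1`; label `i+1`: `t_{Θ,i+1,v}`). [folklore] -/
theorem norm_labelIdele_eq_of_norm_eq
    (hn : ∀ (pp : Nat.Primes) (i : Fin X.lstar) (x : (thetaIndex X).Fibre (.inr pp)), haveI : Fact (pp : ℕ).Prime := ⟨pp.2⟩; ‖t pp i x‖ = ‖t' pp i x‖)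
    (pp : Nat.Primes) (j : (thetaIndex X).Label) (x : (thetaIndex X).Fibre (.inr pp)) :
    haveI : Fact (pp : ℕ).Prime := ⟨pp.2⟩; ‖labelIdele X t pp j x‖ = ‖labelIdele X t' pp j x‖ := by
  unfold labelIdele
  split_ifs with h
  · exact hn pp _ x
  · rfl

/-- **Equal norms, equal Θ-regions — at any two inputs.** For non-zero Θ-ideles `t`, `t'` with `‖t_{Θ,j,v}‖ = ‖t'_{Θ,j,v}‖` everywhere, the
(Ind3)-enlarged Kummer image of the Θ-pilot object at every `(j, v_ℚ)` is the SAME set in the sharp settings at inputs `tq`, `tq'` (the sharp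
translate `ι_j(a)·(R_I)^∼` depends on `‖a‖` only; at `∞` both are the whole packet). [cite: DupuyHilado2025, §3.7, §3.9] -/
theorem thetaRegion3_settingPrVolSharp_eq_of_norm_eq (ht0 : ∀ pp i x, t pp i x ≠ 0) (ht0' : ∀ pp i x, t' pp i x ≠ 0)
    (htq0 : ∀ pp x, tq pp x ≠ 0)
    (htq1 : ∀ (pp : Nat.Primes) (x : (thetaIndex X).Fibre (.inr pp)), haveI : Fact (pp : ℕ).Prime := ⟨pp.2⟩; placeOf X pp.1 x ∉ X.S → ‖tq pp x‖ = 1)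
    (htq0' : ∀ pp x, tq' pp x ≠ 0)
    (htq1' : ∀ (pp : Nat.Primes) (x : (thetaIndex X).Fibre (.inr pp)), haveI : Fact (pp : ℕ).Prime := ⟨pp.2⟩; placeOf X pp.1 x ∉ X.S → ‖tq' pp x‖ = 1)
    (hn : ∀ (pp : Nat.Primes) (i : Fin X.lstar) (x : (thetaIndex X).Fibre (.inr pp)), haveI : Fact (pp : ℕ).Prime := ⟨pp.2⟩; ‖t pp i x‖ = ‖t' pp i x‖)
    (j : (thetaIndex X).Label) (vQ : (thetaIndex X).VQ) :
    (settingPrVolSharp X hlog M archPk archSub Ψ act Mmod region n lat sig split qData tq t htq0 htq1).thetaRegion3 j vQ =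
      (settingPrVolSharp X hlog M archPk archSub Ψ act Mmod region n lat sig split qData tq' t' htq0' htq1').thetaRegion3 j vQ := by
  rw [thetaRegion3_settingPrVolSharp_eq X hlog M archPk archSub Ψ act Mmod region n lat sig split qData t tq htq0 htq1 0,
    thetaRegion3_settingPrVolSharp_eq X hlog M archPk archSub Ψ act Mmod region n lat sig split qData t' tq' htq0' htq1' 0]
  cases vQ with
  | inl u =>
    rw [thetaRegion_settingPrVolSharp_inl X hlog M archPk archSub Ψ act Mmod region n lat sig split qData t tq htq0 htq1 0 j u,
      thetaRegion_settingPrVolSharp_inl X hlog M archPk archSub Ψ act Mmod region n lat sig split qData t' tq' htq0' htq1' 0 j u]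
  | inr pp =>
    haveI : Fact (pp : ℕ).Prime := ⟨pp.2⟩
    rw [thetaRegion_settingPrVolSharp_inr X hlog M archPk archSub Ψ act Mmod region n lat sig split qData t tq htq0 htq1 0 j pp,
      thetaRegion_settingPrVolSharp_inr X hlog M archPk archSub Ψ act Mmod region n lat sig split qData t' tq' htq0' htq1' 0 j pp]
    congr 1
    refine Set.pi_congr rfl fun e _ => ?_
    show iota pp.1 ((presAtPr X hlog pp).kk e) (Fin.last _) (labelIdele X t pp j (e (Fin.last _))) •
        (normalizedPacket pp.1 ((presAtPr X hlog pp).kk e) : Set ((presAtPr X hlog pp).X e)) =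
      iota pp.1 ((presAtPr X hlog pp).kk e) (Fin.last _) (labelIdele X t' pp j (e (Fin.last _))) •
        (normalizedPacket pp.1 ((presAtPr X hlog pp).kk e) : Set ((presAtPr X hlog pp).X e))
    exact iota_smul_normalizedPacket_eq_of_norm_eq_slot pp.1 _ (Fin.last _) (labelIdele_ne_zero X t ht0 pp j _)
      (labelIdele_ne_zero X t' ht0' pp j _) (norm_labelIdele_eq_of_norm_eq X t t' hn pp j _)

/-- … hence the SAME possible images at every `(j, v_ℚ)` (the ⟨(Ind1) ∪ (Ind2)⟩-translates of the same region).
[cite: Mochizuki2012, IUTchIII Cor. 3.12 p. 173 l. 49 – p. 174 l. 3] -/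
theorem possibleImages_settingPrVolSharp_eq_of_norm_eq (ht0 : ∀ pp i x, t pp i x ≠ 0) (ht0' : ∀ pp i x, t' pp i x ≠ 0)
    (htq0 : ∀ pp x, tq pp x ≠ 0)
    (htq1 : ∀ (pp : Nat.Primes) (x : (thetaIndex X).Fibre (.inr pp)), haveI : Fact (pp : ℕ).Prime := ⟨pp.2⟩; placeOf X pp.1 x ∉ X.S → ‖tq pp x‖ = 1)
    (htq0' : ∀ pp x, tq' pp x ≠ 0)
    (htq1' : ∀ (pp : Nat.Primes) (x : (thetaIndex X).Fibre (.inr pp)), haveI : Fact (pp : ℕ).Prime := ⟨pp.2⟩; placeOf X pp.1 x ∉ X.S → ‖tq' pp x‖ = 1)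
    (hn : ∀ (pp : Nat.Primes) (i : Fin X.lstar) (x : (thetaIndex X).Fibre (.inr pp)), haveI : Fact (pp : ℕ).Prime := ⟨pp.2⟩; ‖t pp i x‖ = ‖t' pp i x‖)
    (j : (thetaIndex X).Label) (vQ : (thetaIndex X).VQ) :
    (settingPrVolSharp X hlog M archPk archSub Ψ act Mmod region n lat sig split qData tq t htq0 htq1).possibleImages j vQ =
      (settingPrVolSharp X hlog M archPk archSub Ψ act Mmod region n lat sig split qData tq' t' htq0' htq1').possibleImages j vQ := by
  unfold Cor312.Setting.possibleImages
  rw [thetaRegion3_settingPrVolSharp_eq_of_norm_eq X hlog M archPk archSub Ψ act Mmod region n lat sig split qData t t' tq tq' ht0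
    ht0' htq0 htq1 htq0' htq1' hn j vQ]

/-- … hence the SAME holomorphic hulls `ⁿ˚𝒰_{j,v_ℚ}` (same frame, same family).
[cite: Mochizuki2012, IUTchIII Cor. 3.12 proof p. 174 l. 50–58] -/
theorem thetaHull_settingPrVolSharp_eq_of_norm_eq (ht0 : ∀ pp i x, t pp i x ≠ 0) (ht0' : ∀ pp i x, t' pp i x ≠ 0)
    (htq0 : ∀ pp x, tq pp x ≠ 0)
    (htq1 : ∀ (pp : Nat.Primes) (x : (thetaIndex X).Fibre (.inr pp)), haveI : Fact (pp : ℕ).Prime := ⟨pp.2⟩; placeOf X pp.1 x ∉ X.S → ‖tq pp x‖ = 1)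
    (htq0' : ∀ pp x, tq' pp x ≠ 0)
    (htq1' : ∀ (pp : Nat.Primes) (x : (thetaIndex X).Fibre (.inr pp)), haveI : Fact (pp : ℕ).Prime := ⟨pp.2⟩; placeOf X pp.1 x ∉ X.S → ‖tq' pp x‖ = 1)
    (hn : ∀ (pp : Nat.Primes) (i : Fin X.lstar) (x : (thetaIndex X).Fibre (.inr pp)), haveI : Fact (pp : ℕ).Prime := ⟨pp.2⟩; ‖t pp i x‖ = ‖t' pp i x‖)
    (j : (thetaIndex X).Label) (vQ : (thetaIndex X).VQ) :
    (settingPrVolSharp X hlog M archPk archSub Ψ act Mmod region n lat sig split qData tq t htq0 htq1).thetaHull j vQ =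
      (settingPrVolSharp X hlog M archPk archSub Ψ act Mmod region n lat sig split qData tq' t' htq0' htq1').thetaHull j vQ := by
  unfold Cor312.Setting.thetaHull
  rw [possibleImages_settingPrVolSharp_eq_of_norm_eq X hlog M archPk archSub Ψ act Mmod region n lat sig split qData t t' tq tq' ht0
    ht0' htq0 htq1 htq0' htq1' hn j vQ, frame_settingPrVolSharp X hlog M archPk archSub Ψ act Mmod region n lat sig split qData t tq,
    frame_settingPrVolSharp X hlog M archPk archSub Ψ act Mmod region n lat sig split qData t' tq']

/-- … hence the SAME `−|log(Θ)|` (abc-iut-w5-d044's congruence `Cor312.Setting.negLogTheta_congr`: same column, same frames, same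
possible images). [cite: Mochizuki2012, IUTchIII Cor. 3.12 p. 173–174] -/
theorem negLogTheta_settingPrVolSharp_eq_of_norm_eq (ht0 : ∀ pp i x, t pp i x ≠ 0) (ht0' : ∀ pp i x, t' pp i x ≠ 0)
    (htq0 : ∀ pp x, tq pp x ≠ 0)
    (htq1 : ∀ (pp : Nat.Primes) (x : (thetaIndex X).Fibre (.inr pp)), haveI : Fact (pp : ℕ).Prime := ⟨pp.2⟩; placeOf X pp.1 x ∉ X.S → ‖tq pp x‖ = 1)
    (htq0' : ∀ pp x, tq' pp x ≠ 0)
    (htq1' : ∀ (pp : Nat.Primes) (x : (thetaIndex X).Fibre (.inr pp)), haveI : Fact (pp : ℕ).Prime := ⟨pp.2⟩; placeOf X pp.1 x ∉ X.S → ‖tq' pp x‖ = 1)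
    (hn : ∀ (pp : Nat.Primes) (i : Fin X.lstar) (x : (thetaIndex X).Fibre (.inr pp)), haveI : Fact (pp : ℕ).Prime := ⟨pp.2⟩; ‖t pp i x‖ = ‖t' pp i x‖) :
    (settingPrVolSharp X hlog M archPk archSub Ψ act Mmod region n lat sig split qData tq t htq0 htq1).negLogTheta =
      (settingPrVolSharp X hlog M archPk archSub Ψ act Mmod region n lat sig split qData tq' t' htq0' htq1').negLogTheta := by
  refine negLogTheta_congr _ _ ?_ (fun j vQ => ?_) fun j vQ =>
    possibleImages_settingPrVolSharp_eq_of_norm_eq X hlog M archPk archSub Ψ act Mmod region n lat sig split qData t t' tq tq' ht0 ht0'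
      htq0 htq1 htq0' htq1' hn j vQ
  · rw [settingPrVolSharp_n, settingPrVolSharp_n]
  · rw [frame_settingPrVolSharp X hlog M archPk archSub Ψ act Mmod region n lat sig split qData t tq,
      frame_settingPrVolSharp X hlog M archPk archSub Ψ act Mmod region n lat sig split qData t' tq']

end Norms

/-! ## §2. FAITHFUL constructions `C : q-ideles ↦ Θ-ideles` ((SHE) as typed: the output realises `P_Θ` at every input) carry NO influence -/

section Faithful

variable
  (C : (∀ (pp : Nat.Primes) (x : (thetaIndex X).Fibre (.inr pp)), haveI : Fact (pp : ℕ).Prime := ⟨pp.2⟩; kOf X pp.1 x) →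
    ∀ (pp : Nat.Primes) (_ : Fin X.lstar) (x : (thetaIndex X).Fibre (.inr pp)), haveI : Fact (pp : ℕ).Prime := ⟨pp.2⟩; kOf X pp.1 x)
  (hC0 : ∀ tq pp i x, C tq pp i x ≠ 0)
  /- FAITHFUL: at every input the output Θ-ideles realise `P_Θ` in Dupuy–Hilado's normalisation (3.4) (c312-7's binder `ht`) -/
  (hC : ∀ (tq : ∀ (pp : Nat.Primes) (x : (thetaIndex X).Fibre (.inr pp)), haveI : Fact (pp : ℕ).Prime := ⟨pp.2⟩; kOf X pp.1 x)
      (pp : Nat.Primes) (i : Fin X.lstar) (x : (thetaIndex X).Fibre (.inr pp)),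
      haveI : Fact (pp : ℕ).Prime := ⟨pp.2⟩
      Real.log ‖C tq pp i x‖ = -(X.thetaPilot i (placeOf X pp.1 x)) * logNorm F (placeOf X pp.1 x) / localDegree F (placeOf X pp.1 x))
  (tq tq' : ∀ (pp : Nat.Primes) (x : (thetaIndex X).Fibre (.inr pp)), haveI : Fact (pp : ℕ).Prime := ⟨pp.2⟩; kOf X pp.1 x)

include hC0 hC in
/-- A faithful construction produces output ideles of the SAME norms at any two inputs (`log ‖·‖` is pinned by `P_Θ`).
[cite: DupuyHilado2025, §3.4] -/
theorem norm_eq_of_faithful (pp : Nat.Primes) (i : Fin X.lstar)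
    (x : (thetaIndex X).Fibre (.inr pp)) :
    haveI : Fact (pp : ℕ).Prime := ⟨pp.2⟩; ‖C tq pp i x‖ = ‖C tq' pp i x‖ := by
  haveI : Fact (pp : ℕ).Prime := ⟨pp.2⟩
  have h := (hC tq pp i x).trans (hC tq' pp i x).symm
  exact Real.log_injOn_pos (norm_pos_iff.mpr (hC0 tq pp i x)) (norm_pos_iff.mpr (hC0 tq' pp i x)) h

include hC0 hC in
/-- **RC-639 (H2) for FAITHFUL constructions: the Θ-side OUTPUT DOES NOT DEPEND ON THE INPUT.** For a construction `C : q-ideles ↦ Θ-ideles`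
whose output realises `P_Θ` at every input, the sharp settings at any two inputs `tq`, `tq'` have literally the same (Ind3)-enlarged regions,
the same possible images, the same holomorphic hulls and the same `−|log(Θ)|`. [cite: LANA2026Report, Rmk. 6.2.2 p. 33–34] -/
theorem output_indep_of_input_of_faithful (htq0 : ∀ pp x, tq pp x ≠ 0)
    (htq1 : ∀ (pp : Nat.Primes) (x : (thetaIndex X).Fibre (.inr pp)), haveI : Fact (pp : ℕ).Prime := ⟨pp.2⟩; placeOf X pp.1 x ∉ X.S → ‖tq pp x‖ = 1)
    (htq0' : ∀ pp x, tq' pp x ≠ 0)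
    (htq1' : ∀ (pp : Nat.Primes) (x : (thetaIndex X).Fibre (.inr pp)), haveI : Fact (pp : ℕ).Prime := ⟨pp.2⟩; placeOf X pp.1 x ∉ X.S → ‖tq' pp x‖ = 1) :
    (∀ (j : (thetaIndex X).Label) (vQ : (thetaIndex X).VQ), (settingPrVolSharp X hlog M archPk archSub Ψ act Mmod region n lat sig split qData tq (C tq) htq0 htq1).thetaRegion3 j vQ =
          (settingPrVolSharp X hlog M archPk archSub Ψ act Mmod region n lat sig split qData tq' (C tq') htq0' htq1').thetaRegion3 j vQ) ∧
      (∀ (j : (thetaIndex X).Label) (vQ : (thetaIndex X).VQ), (settingPrVolSharp X hlog M archPk archSub Ψ act Mmod region n lat sig split qData tq (C tq) htq0 htq1).possibleImages j vQ =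
          (settingPrVolSharp X hlog M archPk archSub Ψ act Mmod region n lat sig split qData tq' (C tq') htq0' htq1').possibleImages j vQ) ∧
      (∀ (j : (thetaIndex X).Label) (vQ : (thetaIndex X).VQ), (settingPrVolSharp X hlog M archPk archSub Ψ act Mmod region n lat sig split qData tq (C tq) htq0 htq1).thetaHull j vQ =
          (settingPrVolSharp X hlog M archPk archSub Ψ act Mmod region n lat sig split qData tq' (C tq') htq0' htq1').thetaHull j vQ) ∧
      (settingPrVolSharp X hlog M archPk archSub Ψ act Mmod region n lat sig split qData tq (C tq) htq0 htq1).negLogTheta =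
        (settingPrVolSharp X hlog M archPk archSub Ψ act Mmod region n lat sig split qData tq' (C tq') htq0' htq1').negLogTheta := by
  have hn := norm_eq_of_faithful X C hC0 hC tq tq'
  exact ⟨thetaRegion3_settingPrVolSharp_eq_of_norm_eq X hlog M archPk archSub Ψ act Mmod region n lat sig split qData (C tq) (C tq') tq tq'
      (hC0 tq) (hC0 tq') htq0 htq1 htq0' htq1' hn,
    possibleImages_settingPrVolSharp_eq_of_norm_eq X hlog M archPk archSub Ψ act Mmod region n lat sig split qData (C tq) (C tq') tq tq'
      (hC0 tq) (hC0 tq') htq0 htq1 htq0' htq1' hn,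
    thetaHull_settingPrVolSharp_eq_of_norm_eq X hlog M archPk archSub Ψ act Mmod region n lat sig split qData (C tq) (C tq') tq tq'
      (hC0 tq) (hC0 tq') htq0 htq1 htq0' htq1' hn,
    negLogTheta_settingPrVolSharp_eq_of_norm_eq X hlog M archPk archSub Ψ act Mmod region n lat sig split qData (C tq) (C tq') tq tq'
      (hC0 tq) (hC0 tq') htq0 htq1 htq0' htq1' hn⟩

include hC0 hC in
/-- **… so (9-1) AS TYPED (`Repair.CandLana1.H`) is FALSE at every input realising `P_q` of a faithful construction** (gen 0's
`RLana91GenuineBed.not_H_settingPrVolSharp` at the output ideles `C tq`: `−deĝ̲_lgp(P_Θ) < −deĝ̲(P_q) = −|log(q)|`). HORN (H2) AS TYPED, faithful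
case: KILLED-as-supplier. [cite: LANA2026Report, Rmk. 6.2.2 p. 33–34; §9.2 (9-1) p. 46] [cite: DupuyHilado2025, Thm. 3.10.1] -/
theorem not_H_of_faithful (htq0 : ∀ pp x, tq pp x ≠ 0)
    (htq1 : ∀ (pp : Nat.Primes) (x : (thetaIndex X).Fibre (.inr pp)), haveI : Fact (pp : ℕ).Prime := ⟨pp.2⟩; placeOf X pp.1 x ∉ X.S → ‖tq pp x‖ = 1)
    (htq : ∀ (pp : Nat.Primes) (x : (thetaIndex X).Fibre (.inr pp)),
      haveI : Fact (pp : ℕ).Prime := ⟨pp.2⟩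
      Real.log ‖tq pp x‖ = -(X.qPilot (placeOf X pp.1 x)) * logNorm F (placeOf X pp.1 x) / localDegree F (placeOf X pp.1 x)) :
    ¬ Repair.CandLana1.H
      (LatticeSituation.ofShells (logShellsDH X logv) M archPk archSub (summandPiecesPr X hlog).Adm
        (summandPiecesPr X hlog).logvol Ψ act Mmod region frobAdm frobLogvol frobΨ frobMmod unitImage ballImage thetaDiv)
      (settingPrVolSharp X hlog M archPk archSub Ψ act Mmod region n lat sig split qData tq (C tq) htq0 htq1) ρ qK :=
  not_H_settingPrVolSharp X hlog M archPk archSub Ψ act Mmod region frobAdm frobLogvol frobΨ frobMmod unitImage ballImage thetaDiv n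
    lat sig split qData (C tq) tq ρ qK (hC0 tq) (hC tq) htq0 htq1 htq

end Faithful

/-! ## §3. What an influence would have to be: output ideles with the q-pilot's norms make (9-1) true — and are not the Θ-pilot's -/

section NormTransfer

variable (t : ∀ (pp : Nat.Primes) (_ : Fin X.lstar) (x : (thetaIndex X).Fibre (.inr pp)),
    haveI : Fact (pp : ℕ).Prime := ⟨pp.2⟩; kOf X pp.1 x)
  (tq : ∀ (pp : Nat.Primes) (x : (thetaIndex X).Fibre (.inr pp)), haveI : Fact (pp : ℕ).Prime := ⟨pp.2⟩; kOf X pp.1 x)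

/-- **If the output ideles carry the q-pilot's norms at every label, the q-pilot region IS a possible image in EVERY packet `(j, v_ℚ)`,
`j ∈ 𝔽_l^⋇`** (reading R3 everywhere: abc-iut-c312-7 `qRegion_mem_possibleImages_settingPrVolSharp_of_norm_eq` at the primes, `…_inl` at `∞`).
[cite: DupuyHilado2025, §3.7, §3.9] [claim: Mochizuki2012, status: disputed] -/
theorem reading3_settingPrVolSharp_of_norm_eq (ht0 : ∀ pp i x, t pp i x ≠ 0) (htq0 : ∀ pp x, tq pp x ≠ 0)
    (htq1 : ∀ (pp : Nat.Primes) (x : (thetaIndex X).Fibre (.inr pp)), haveI : Fact (pp : ℕ).Prime := ⟨pp.2⟩; placeOf X pp.1 x ∉ X.S → ‖tq pp x‖ = 1)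
    (heq : ∀ (pp : Nat.Primes) (i : Fin X.lstar) (x : (thetaIndex X).Fibre (.inr pp)), haveI : Fact (pp : ℕ).Prime := ⟨pp.2⟩; ‖t pp i x‖ = ‖tq pp x‖)
    (i : Fin (thetaIndex X).lstar) (vQ : (thetaIndex X).VQ) :
    (settingPrVolSharp X hlog M archPk archSub Ψ act Mmod region n lat sig split qData tq t htq0 htq1).qRegion (labelSucc i) vQ ∈
      (settingPrVolSharp X hlog M archPk archSub Ψ act Mmod region n lat sig split qData tq t htq0 htq1).possibleImages (labelSucc i) vQ := by
  cases vQ with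
  | inl u =>
    exact qRegion_mem_possibleImages_settingPrVolSharp_inl X hlog M archPk archSub Ψ act Mmod region n lat sig split qData t tq htq0 htq1
      _ u
  | inr pp =>
    exact qRegion_mem_possibleImages_settingPrVolSharp_of_norm_eq X hlog M archPk archSub Ψ act Mmod region n lat sig split qData t ht0
      tq htq0 htq1 i pp (heq pp i)

/-- **… so the per-cell IDENTIFICATION family holds at EVERY cell** (gen 0's `RLana91CellGrain.CellVolId`: the q-pilot image itself is the
possible image with the q-pilot's volume). [cite: LANA2026Report, §9.3 p. 46] -/
theorem forall_cellVolId_settingPrVolSharp_of_norm_eq (ht0 : ∀ pp i x, t pp i x ≠ 0) (htq0 : ∀ pp x, tq pp x ≠ 0)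
    (htq1 : ∀ (pp : Nat.Primes) (x : (thetaIndex X).Fibre (.inr pp)), haveI : Fact (pp : ℕ).Prime := ⟨pp.2⟩; placeOf X pp.1 x ∉ X.S → ‖tq pp x‖ = 1)
    (heq : ∀ (pp : Nat.Primes) (i : Fin X.lstar) (x : (thetaIndex X).Fibre (.inr pp)), haveI : Fact (pp : ℕ).Prime := ⟨pp.2⟩; ‖t pp i x‖ = ‖tq pp x‖)
    (i : Fin (thetaIndex X).lstar) (vQ : (thetaIndex X).VQ) :
    CellVolId (settingPrVolSharp X hlog M archPk archSub Ψ act Mmod region n lat sig split qData tq t htq0 htq1) i vQ :=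
  ⟨_, reading3_settingPrVolSharp_of_norm_eq X hlog M archPk archSub Ψ act Mmod region n lat sig split qData t tq ht0 htq0 htq1 heq i vQ,
    rfl⟩

/-- **… and (9-1) AS TYPED (`Repair.CandLana1.H`) HOLDS** (`CandLana1.H_of_reading3`: the q-pilot images are a global possible image with
procession-normalised volume `−|log(q)|`). [cite: LANA2026Report, §9.2 (9-1) p. 46] -/
theorem H_settingPrVolSharp_of_norm_eq (ht0 : ∀ pp i x, t pp i x ≠ 0) (htq0 : ∀ pp x, tq pp x ≠ 0)
    (htq1 : ∀ (pp : Nat.Primes) (x : (thetaIndex X).Fibre (.inr pp)), haveI : Fact (pp : ℕ).Prime := ⟨pp.2⟩; placeOf X pp.1 x ∉ X.S → ‖tq pp x‖ = 1)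
    (heq : ∀ (pp : Nat.Primes) (i : Fin X.lstar) (x : (thetaIndex X).Fibre (.inr pp)), haveI : Fact (pp : ℕ).Prime := ⟨pp.2⟩; ‖t pp i x‖ = ‖tq pp x‖) :
    Repair.CandLana1.H
      (LatticeSituation.ofShells (logShellsDH X logv) M archPk archSub (summandPiecesPr X hlog).Adm
        (summandPiecesPr X hlog).logvol Ψ act Mmod region frobAdm frobLogvol frobΨ frobMmod unitImage ballImage thetaDiv)
      (settingPrVolSharp X hlog M archPk archSub Ψ act Mmod region n lat sig split qData tq t htq0 htq1) ρ qK :=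
  Repair.CandLana1.H_of_reading3 _ _ ρ qK fun i vQ =>
    reading3_settingPrVolSharp_of_norm_eq X hlog M archPk archSub Ψ act Mmod region n lat sig split qData t tq ht0 htq0 htq1 heq i vQ

include hlog M archPk archSub Ψ act Mmod region frobAdm frobLogvol frobΨ frobMmod unitImage ballImage thetaDiv n lat sig split qData ρ qK in
/-- **… but such output ideles do NOT realise `P_Θ`** when the input realises `P_q`: if they did, §2 (gen 0's
`RLana91GenuineBed.not_H_settingPrVolSharp`) would refute the (9-1) just proved. The influence that makes (9-1) true REPLACES the Θ-pilot's
value-group part (`P_{Θ,j} = j²·P_q`, theta values `q^{j²}`) by the q-pilot's. [cite: DupuyHilado2025, §3.3, Thm. 3.10.1]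
[cite: LANA2026Report, Rmk. 6.2.2 p. 33–34] -/
theorem not_realisesTheta_of_norm_eq (ht0 : ∀ pp i x, t pp i x ≠ 0) (htq0 : ∀ pp x, tq pp x ≠ 0)
    (htq1 : ∀ (pp : Nat.Primes) (x : (thetaIndex X).Fibre (.inr pp)), haveI : Fact (pp : ℕ).Prime := ⟨pp.2⟩; placeOf X pp.1 x ∉ X.S → ‖tq pp x‖ = 1)
    (htq : ∀ (pp : Nat.Primes) (x : (thetaIndex X).Fibre (.inr pp)),
      haveI : Fact (pp : ℕ).Prime := ⟨pp.2⟩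
      Real.log ‖tq pp x‖ = -(X.qPilot (placeOf X pp.1 x)) * logNorm F (placeOf X pp.1 x) / localDegree F (placeOf X pp.1 x))
    (heq : ∀ (pp : Nat.Primes) (i : Fin X.lstar) (x : (thetaIndex X).Fibre (.inr pp)), haveI : Fact (pp : ℕ).Prime := ⟨pp.2⟩; ‖t pp i x‖ = ‖tq pp x‖) :
    ¬ ∀ (pp : Nat.Primes) (i : Fin X.lstar) (x : (thetaIndex X).Fibre (.inr pp)),
        haveI : Fact (pp : ℕ).Prime := ⟨pp.2⟩
        Real.log ‖t pp i x‖ = -(X.thetaPilot i (placeOf X pp.1 x)) * logNorm F (placeOf X pp.1 x) / localDegree F (placeOf X pp.1 x) :=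
  fun ht => not_H_settingPrVolSharp X hlog M archPk archSub Ψ act Mmod region frobAdm frobLogvol frobΨ frobMmod unitImage ballImage
    thetaDiv n lat sig split qData t tq ρ qK ht0 ht htq0 htq1 htq
    (H_settingPrVolSharp_of_norm_eq X hlog M archPk archSub Ψ act Mmod region frobAdm frobLogvol frobΨ frobMmod unitImage ballImage
      thetaDiv n lat sig split qData ρ qK t tq ht0 htq0 htq1 heq)

/-- **The q-MOVER construction `C tq := (j ↦ tq)`** (output Θ-ideles := the input's q-ideles at every label): (9-1) AS TYPED HOLDS at the
genuine sharp bed for EVERY input (norm transfer with `‖t‖ = ‖tq‖` on the nose). The Θ-side twin, at the genuine bed, of the catalogue's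
«q-mover» door (RC-513 `Repair.CandJoshiLanaQMover`). [cite: LANA2026Report, Rmk. 6.2.2 p. 33–34; §9.2 (9-1) p. 46] -/
theorem H_settingPrVolSharp_qMover (htq0 : ∀ pp x, tq pp x ≠ 0)
    (htq1 : ∀ (pp : Nat.Primes) (x : (thetaIndex X).Fibre (.inr pp)), haveI : Fact (pp : ℕ).Prime := ⟨pp.2⟩; placeOf X pp.1 x ∉ X.S → ‖tq pp x‖ = 1) :
    Repair.CandLana1.H
      (LatticeSituation.ofShells (logShellsDH X logv) M archPk archSub (summandPiecesPr X hlog).Adm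
        (summandPiecesPr X hlog).logvol Ψ act Mmod region frobAdm frobLogvol frobΨ frobMmod unitImage ballImage thetaDiv)
      (settingPrVolSharp X hlog M archPk archSub Ψ act Mmod region n lat sig split qData tq (fun pp _ x => tq pp x) htq0 htq1) ρ qK :=
  H_settingPrVolSharp_of_norm_eq X hlog M archPk archSub Ψ act Mmod region frobAdm frobLogvol frobΨ frobMmod unitImage ballImage thetaDiv
    n lat sig split qData ρ qK (fun pp _ x => tq pp x) tq (fun pp _ x => htq0 pp x) htq0 htq1 fun _ _ _ => rfl

include hlog M archPk archSub Ψ act Mmod region frobAdm frobLogvol frobΨ frobMmod unitImage ballImage thetaDiv n lat sig split qData ρ qK in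
/-- **… and the q-mover's output does not realise `P_Θ`** (for inputs realising `P_q`). [cite: DupuyHilado2025, §3.3, Thm. 3.10.1] -/
theorem qMover_not_realisesTheta (htq0 : ∀ pp x, tq pp x ≠ 0)
    (htq1 : ∀ (pp : Nat.Primes) (x : (thetaIndex X).Fibre (.inr pp)), haveI : Fact (pp : ℕ).Prime := ⟨pp.2⟩; placeOf X pp.1 x ∉ X.S → ‖tq pp x‖ = 1)
    (htq : ∀ (pp : Nat.Primes) (x : (thetaIndex X).Fibre (.inr pp)),
      haveI : Fact (pp : ℕ).Prime := ⟨pp.2⟩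
      Real.log ‖tq pp x‖ = -(X.qPilot (placeOf X pp.1 x)) * logNorm F (placeOf X pp.1 x) / localDegree F (placeOf X pp.1 x)) :
    ¬ ∀ (pp : Nat.Primes) (i : Fin X.lstar) (x : (thetaIndex X).Fibre (.inr pp)),
        haveI : Fact (pp : ℕ).Prime := ⟨pp.2⟩
        Real.log ‖tq pp x‖ = -(X.thetaPilot i (placeOf X pp.1 x)) * logNorm F (placeOf X pp.1 x) / localDegree F (placeOf X pp.1 x) :=
  not_realisesTheta_of_norm_eq X hlog M archPk archSub Ψ act Mmod region frobAdm frobLogvol frobΨ frobMmod unitImage ballImage thetaDiv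
    n lat sig split qData ρ qK (fun pp _ x => tq pp x) tq (fun pp _ x => htq0 pp x) htq0 htq1 htq fun _ _ _ => rfl

/-! ## §4. The general construction: (9-1) at an input is a CONSTRAINT on the output's Kummer image -/

/-- **(9-1) AS TYPED at input `tq` with ANY non-zero output ideles `t` ⟺ the procession-normalised volume of the output's OWN (Ind3)-enlarged
Kummer images is `−|log(q)|`**: every possible image has, packet by packet, the volume of the enlarged region (gen 0's
`logvol_eq_logvol_thetaRegion3_of_mem_possibleImages_settingPrVolSharp` — (Ind1)/(Ind2) volume-preserving, Step (x) p. 181), and the enlarged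
regions are themselves a global possible image. The comparison relativised to a construction `C` (take `t := C tq`) is thus a CONSTRAINT ON `C`,
not a consequence of having one (abc-iut-c312-4 `LanaProcedure.mainGoal_is_the_extra_input`, per input).
[cite: LANA2026Report, §9.2 (9-1) p. 46] [cite: Mochizuki2012, IUTchIII Cor. 3.12 proof Step (x) p. 181] -/
theorem H_settingPrVolSharp_iff_kummerImage (ht0 : ∀ pp i x, t pp i x ≠ 0) (htq0 : ∀ pp x, tq pp x ≠ 0)
    (htq1 : ∀ (pp : Nat.Primes) (x : (thetaIndex X).Fibre (.inr pp)), haveI : Fact (pp : ℕ).Prime := ⟨pp.2⟩; placeOf X pp.1 x ∉ X.S → ‖tq pp x‖ = 1) :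
    Repair.CandLana1.H
        (LatticeSituation.ofShells (logShellsDH X logv) M archPk archSub (summandPiecesPr X hlog).Adm
          (summandPiecesPr X hlog).logvol Ψ act Mmod region frobAdm frobLogvol frobΨ frobMmod unitImage ballImage thetaDiv)
        (settingPrVolSharp X hlog M archPk archSub Ψ act Mmod region n lat sig split qData tq t htq0 htq1) ρ qK ↔
      processionNormalized (fun i : Fin (thetaIndex X).lstar => ∑ᶠ vQ : (thetaIndex X).VQ,
          ((situationPrVol X hlog M archPk archSub Ψ act Mmod region).D n).logvol (labelSucc i) vQ
            ((settingPrVolSharp X hlog M archPk archSub Ψ act Mmod region n lat sig split qData tq t htq0 htq1).thetaRegion3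
              (labelSucc i) vQ)) =
        (settingPrVolSharp X hlog M archPk archSub Ψ act Mmod region n lat sig split qData tq t htq0 htq1).negLogQ := by
  constructor
  · rintro ⟨U, hU⟩
    refine Eq.trans ?_ hU
    congr 1
    funext i
    exact finsum_congr fun vQ =>
      (logvol_eq_logvol_thetaRegion3_of_mem_possibleImages_settingPrVolSharp X hlog M archPk archSub Ψ act Mmod region n lat sig split
        qData t tq ht0 htq0 htq1 _ vQ (U.2 (i, vQ))).symm
  · intro h
    exact ⟨⟨fun c => (settingPrVolSharp X hlog M archPk archSub Ψ act Mmod region n lat sig split qData tq t htq0 htq1).thetaRegion3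
        (labelSucc c.1) c.2, fun c => Setting.thetaRegion3_mem_possibleImages _ _ _⟩, h⟩

end NormTransfer

end Summit.ABC.IUTFork.Repair.RLana91InputConstruction

end
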